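import Summits.QuantumAdvantage.QuantumAdvantage.Theorems.LinnikCubicClassGroupsDegreeOnePrimesEscapeMertensLinnikRange
import Literature.NumberTheory.LFunctions.MertensNumberFieldResidueLimit
import HarnessLib

/-!
# Mertens' THIRD theorem for number fields, uniformly in the Linnik range:
# `∏_{N𝔭 ≤ x} (1 − 1/N𝔭)^{-1} = e^{γ} κ_K log x · exp(O_n((log Q/log x)²))` — the residue `κ_K` of a field
# without quadratic subfield is determined, to within a factor `e^{±ε}`, by its prime ideals of norm `≤ Q^{C(n,ε)}`

Topic `Summits/QuantumAdvantage/QuantumAdvantage/Theorems`, cell B2b-1 (linnik-cubic), PART A (maintenance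
seat, generation 15); helper for the crux `DegreeOnePrimesEscape` (stmt-QuantumAdvantage-11543) of route
`LinnikCubicClassGroups`.  HONEST FRAMING: the value of this file is a THEOREM (kernel-checked, GRH-free,
Siegel-free) — NOT summit progress (the route rests on the hypothesis-type target `PureCubicClassNumberHard`).

From the uniform Mertens II (`mertens_second_uniform_of_mertensConstant`, previous file) and Rosen's
identification of Mertens' constant `M_K − γ + ∑_m r_m(1) = log κ_K` with the tail bound `∑_{m > N} r_m(1) ≤
2[K:ℚ]/N` (Literature `MertensNumberFieldResidue(Limit).lean`, every number field):

* `mertens_third_uniform` — **for `n > 1` there is `Γ = Γ(n)` such that for every number field `K` of degree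
  `n` WITHOUT QUADRATIC SUBFIELD and all `x ≥ 2`:
  `|∑_{N𝔭 ≤ x} −log(1 − 1/N𝔭) − (log log x + γ + log κ_K)| ≤ Γ·(log Q)²/(log x)²`** (`Q = |d_K|·nⁿ`,
  `κ_K` = `dedekindZeta_residue K`), i.e. `∏_{N𝔭 ≤ x}(1 − 1/N𝔭)^{-1} = e^{γ} κ_K log x · e^{θ Γ (log Q/log x)²}`,
  `|θ| ≤ 1`;
* `mertens_third_uniform_eps` — for every `ε > 0`: `|log(∏_{N𝔭 ≤ x}(1 − 1/N𝔭)^{-1}) − log(e^γ κ_K log x)| ≤ ε`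
  for all `x ≥ Q^{Γ/ε + 1}`;
* `mertens_third_uniform_of_odd`, `mertens_third_uniform_cubic` — every field of odd degree, every cubic field.

READING (a NON-advantage certificate for the summit's bookkeeping): by the class number formula
`κ_K = 2^{r₁}(2π)^{r₂} h_K R_K /(w_K √|d_K|)`, the product `h_K R_K` of any cubic (indeed any
no-quadratic-subfield) field is determined to within a factor `e^{±ε}` by the splitting of the rational primes
`p ≤ (27|d_K|)^{C(ε)}` — polynomially many bits of prime-splitting data, no GRH, no Siegel hypothesis.  The
hardness hypothesis of the route (`PureCubicClassNumberHard`: the exact class number `h_K`) is NOT touched: it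
lives in separating `h_K` from `R_K`, not in the size of `h_K R_K`.

In print: uniform Mertens theorems for number fields have error `Υ_K/log x` with `Υ_K ≍ |d_K|^{1/(n+1)}`
(Garcia–Lee 2021) or need `log x ≫ log²|d_K|` (Lebacque 2007); the polynomial range `x ≥ Q^{C}` here comes from
the Linnik-range prime ideal theorem with decaying error (`…ThetaDecay.lean`: log-free zero density + Stark).

## References

* M. Rosen, *A generalization of Mertens' theorem*, J. Ramanujan Math. Soc. 14 (1999), Theorem 2. [Rosen1999Mertens]
* S. R. Garcia, E. S. Lee, Ramanujan J. (2021), Thm 1 (arXiv:2007.10313); P. Lebacque, Acta Arith. 130 (2007).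
* J. Thorner, A. Zaman, ANT 13 (2019), Thm 1.4. [ThornerZaman2019]
-/

noncomputable section

open Finset Real MeasureTheory Filter Set Topology
open scoped NumberField

namespace Summit.QuantumAdvantage.QuantumAdvantage.Theorems.DegreeOnePrimesEscape

open Literature.NumberTheory.LFunctions Literature.NumberTheory.LFunctions.NumberField

/-- **Mertens' third theorem for number fields, uniformly in the Linnik range** (see the module docstring): for
`n > 1` there is `Γ = Γ(n) > 0` such that for every number field `K` of degree `n` without quadratic subfield and
every `x ≥ 2`, `|∑_{N𝔭 ≤ x} −log(1 − 1/N𝔭) − (log log x + γ + log κ_K)| ≤ Γ·(log Q)²/(log x)²`. -/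
theorem mertens_third_uniform (n : ℕ) (hn : 1 < n) :
    ∃ Γ : ℝ, 0 < Γ ∧ ∀ (K : Type) [Field K] [NumberField K], Module.finrank ℚ K = n →
      (∀ F : IntermediateField ℚ K, Module.finrank ℚ F ≠ 2) →
      ∀ x : ℝ, 2 ≤ x →
        |∑ P ∈ (finite_primeIdealsLE K x).toFinset, -Real.log (1 - (Ideal.absNorm P : ℝ)⁻¹) -
            (Real.log (Real.log x) + Real.eulerMascheroniConstant +
              Real.log (NumberField.dedekindZeta_residue K))| ≤
          Γ * Real.log (ThornerZaman.condQn K) ^ 2 / Real.log x ^ 2 := by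
  obtain ⟨Γ₁, hΓ₁, hU⟩ := mertens_second_uniform_of_mertensConstant n hn
  refine ⟨Γ₁ + 16 * n, by positivity, fun K _ _ hKn hnq x hx ↦ ?_⟩
  have hK : 1 < Module.finrank ℚ K := by rw [hKn]; exact hn
  obtain ⟨M, C, hM⟩ := exists_mertensConstant K
  have hid := mertensConstant_eq_log_residue hM
  have hUK := hU K hKn hnq M C hM
  set Q : ℝ := ThornerZaman.condQn K with hQ
  have hQ12 : (12 : ℝ) ≤ Q := ThornerZaman.twelve_le_condQn (K := K) hK
  have hlog12 : (2 : ℝ) ≤ Real.log 12 := by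
    rw [Real.le_log_iff_exp_le (by norm_num)]
    have := Real.exp_one_lt_d9
    have h : Real.exp 2 = Real.exp 1 * Real.exp 1 := by rw [← Real.exp_add]; norm_num
    rw [h]; nlinarith [Real.exp_pos (1:ℝ)]
  have hlogQ : 2 ≤ Real.log Q := hlog12.trans (Real.log_le_log (by norm_num) hQ12)
  have hlogQ1 : 1 ≤ Real.log Q ^ 2 := by nlinarith
  have hx0 : 0 < x := by linarith
  have hlx : 0 < Real.log x := Real.log_pos (by linarith)
  set N : ℕ := ⌊x⌋₊ with hN
  have hN2 : 2 ≤ N := Nat.le_floor (by simpa using hx)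
  have hN1 : 1 ≤ N := by omega
  have hNx : x / 2 ≤ (N : ℝ) := by
    have := Nat.lt_floor_add_one x
    rw [← hN] at this
    linarith
  -- the pieces
  have hS := hUK x hx
  rw [sum_inv_absNorm_eq_normSum K hx0.le] at hS
  have hsplit : ∑' m : ℕ, rTerm K m 1 = ∑ m ∈ Icc 0 N, rTerm K m 1 + ∑' m : ℕ, rTerm K (m + (N + 1)) 1 := by
    rw [← range_succ_eq_Icc_zero, (summable_rTerm K le_rfl).sum_add_tsum_nat_add (N + 1)]
  have htail := abs_tsum_rTerm_shift_le K hN1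
  rw [hKn] at htail
  -- the identity
  have hmain : ∑ P ∈ (finite_primeIdealsLE K x).toFinset, -Real.log (1 - (Ideal.absNorm P : ℝ)⁻¹) -
      (Real.log (Real.log x) + Real.eulerMascheroniConstant + Real.log (NumberField.dedekindZeta_residue K)) =
      (∑ m ∈ Icc 0 N, (normPrimeIdealCount K m : ℝ) / m - (Real.log (Real.log x) + M)) -
        ∑' m : ℕ, rTerm K (m + (N + 1)) 1 := by
    rw [sum_neg_log_eq_sum_wTerm K hx0.le, sum_wTerm_one_eq, ← hid, hsplit]
    ring
  rw [hmain]
  -- bounds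
  have htail' : |∑' m : ℕ, rTerm K (m + (N + 1)) 1| ≤ 16 * (n : ℝ) * Real.log Q ^ 2 / Real.log x ^ 2 := by
    refine htail.trans ?_
    have hN0 : (0 : ℝ) < N := by linarith
    -- `(log x)² ≤ 4x` (`log x ≤ 2√x`; cf. `Literature.NumberTheory.Transcendental.log_sq_le_four_mul`)
    have hlog4 : Real.log x ^ 2 ≤ 4 * x := by
      have h1 : Real.log x ≤ x ^ ((1 : ℝ) / 2) / ((1 : ℝ) / 2) := Real.log_le_rpow_div hx0.le (by norm_num)
      have hsq : (x ^ ((1 : ℝ) / 2)) ^ 2 = x := by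
        rw [← Real.rpow_natCast, ← Real.rpow_mul hx0.le]; norm_num
      have h0 : 0 ≤ x ^ ((1 : ℝ) / 2) := by positivity
      have hl : 0 ≤ Real.log x := hlx.le
      have h2 : Real.log x ≤ 2 * x ^ ((1 : ℝ) / 2) := by linarith
      nlinarith
    have hn0 : (0 : ℝ) ≤ n := Nat.cast_nonneg _
    rw [div_le_div_iff₀ hN0 (by positivity)]
    -- `2n (log x)² ≤ 2n · 4x ≤ 16 n N ≤ 16 n N (log Q)²`
    have h1 : 2 * (n : ℝ) * Real.log x ^ 2 ≤ 16 * (n : ℝ) * (N : ℝ) := by nlinarith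
    have h2 : 16 * (n : ℝ) * (N : ℝ) ≤ 16 * (n : ℝ) * Real.log Q ^ 2 * N := by
      have : 16 * (n : ℝ) * (N : ℝ) * 1 ≤ 16 * (n : ℝ) * (N : ℝ) * Real.log Q ^ 2 :=
        mul_le_mul_of_nonneg_left hlogQ1 (by positivity)
      linarith
    linarith
  calc |∑ m ∈ Icc 0 N, (normPrimeIdealCount K m : ℝ) / m - (Real.log (Real.log x) + M) -
        ∑' m : ℕ, rTerm K (m + (N + 1)) 1|
      ≤ |∑ m ∈ Icc 0 N, (normPrimeIdealCount K m : ℝ) / m - (Real.log (Real.log x) + M)| +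
        |∑' m : ℕ, rTerm K (m + (N + 1)) 1| := abs_sub _ _
    _ ≤ Γ₁ * Real.log Q ^ 2 / Real.log x ^ 2 + 16 * (n : ℝ) * Real.log Q ^ 2 / Real.log x ^ 2 :=
        add_le_add hS htail'
    _ = (Γ₁ + 16 * n) * Real.log Q ^ 2 / Real.log x ^ 2 := by ring

/-- **The `ε`-form** — the residue `κ_K` (hence `h_K R_K`) is determined to within `e^{±ε}` by the prime ideals of
norm `≤ Q^{Γ/ε + 1}`: for every `K` of degree `n` without quadratic subfield, every `ε > 0` and every
`x ≥ Q^{Γ/ε+1}`, `|∑_{N𝔭 ≤ x} −log(1 − 1/N𝔭) − (log log x + γ + log κ_K)| ≤ ε`. -/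
theorem mertens_third_uniform_eps (n : ℕ) (hn : 1 < n) :
    ∃ Γ : ℝ, 0 < Γ ∧ ∀ (K : Type) [Field K] [NumberField K], Module.finrank ℚ K = n →
      (∀ F : IntermediateField ℚ K, Module.finrank ℚ F ≠ 2) →
      ∀ ε : ℝ, 0 < ε → ∀ x : ℝ, ThornerZaman.condQn K ^ (Γ / ε + 1) ≤ x →
        |∑ P ∈ (finite_primeIdealsLE K x).toFinset, -Real.log (1 - (Ideal.absNorm P : ℝ)⁻¹) -
            (Real.log (Real.log x) + Real.eulerMascheroniConstant +
              Real.log (NumberField.dedekindZeta_residue K))| ≤ ε := by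
  obtain ⟨Γ, hΓ, h⟩ := mertens_third_uniform n hn
  refine ⟨Γ, hΓ, fun K _ _ hKn hnq ε hε x hx ↦ ?_⟩
  have hK : 1 < Module.finrank ℚ K := by rw [hKn]; exact hn
  set Q : ℝ := ThornerZaman.condQn K with hQ
  have hQ12 : (12 : ℝ) ≤ Q := ThornerZaman.twelve_le_condQn (K := K) hK
  have hQ1 : (1 : ℝ) < Q := by linarith
  have hQ0 : (0 : ℝ) < Q := by linarith
  have hlogQ0 : 0 < Real.log Q := Real.log_pos hQ1
  have hΓε : (0 : ℝ) ≤ Γ / ε := by positivity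
  have hC1 : (1 : ℝ) ≤ Γ / ε + 1 := by linarith
  have hxQ : Q ≤ x := by
    have : Q ^ (1 : ℝ) ≤ Q ^ (Γ / ε + 1) := Real.rpow_le_rpow_of_exponent_le hQ1.le hC1
    rw [Real.rpow_one] at this; linarith
  have hx2 : 2 ≤ x := by linarith
  have hlogx : (Γ / ε + 1) * Real.log Q ≤ Real.log x := by
    have := Real.log_le_log (by positivity) hx
    rwa [Real.log_rpow hQ0] at this
  have hlx0 : 0 < Real.log x := by nlinarith
  refine (h K hKn hnq x hx2).trans ?_
  rw [div_le_iff₀ (by positivity)]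
  have h1 : Γ * Real.log Q ^ 2 ≤ ε * ((Γ / ε + 1) * Real.log Q) ^ 2 := by
    have hε2 : Γ ≤ ε * (Γ / ε + 1) ^ 2 := by
      have hGe : ε * (Γ / ε) = Γ := by field_simp
      nlinarith [mul_pos hε (show (0:ℝ) < (Γ / ε) ^ 2 + Γ / ε + 1 by positivity)]
    nlinarith [sq_nonneg (Real.log Q)]
  have h2 : ((Γ / ε + 1) * Real.log Q) ^ 2 ≤ Real.log x ^ 2 := by
    have h0 : 0 ≤ (Γ / ε + 1) * Real.log Q := by positivity
    nlinarith
  nlinarith [hε]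

/-- **`h_K · R_K` from the small primes** (the class number formula `κ_K = 2^{r₁}(2π)^{r₂} h_K R_K/(w_K √|d_K|)` is
Mathlib's DEFINITION of `dedekindZeta_residue`): for `K` of degree `n` without quadratic subfield and `x ≥ 2`,
`|log(h_K R_K) − (∑_{N𝔭 ≤ x} −log(1 − 1/N𝔭) − log log x − γ − log(2^{r₁}(2π)^{r₂}) + log(w_K √|d_K|))| ≤ Γ(n)(log Q)²/(log x)²`
— the product of class number and regulator is determined to within `e^{±ε}` by the prime ideals of norm
`≤ Q^{Γ/ε+1}` (a NON-advantage certificate: no GRH, no Siegel hypothesis, polynomially many primes). -/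
theorem abs_log_classNumber_mul_regulator_sub_le (n : ℕ) (hn : 1 < n) :
    ∃ Γ : ℝ, 0 < Γ ∧ ∀ (K : Type) [Field K] [NumberField K], Module.finrank ℚ K = n →
      (∀ F : IntermediateField ℚ K, Module.finrank ℚ F ≠ 2) →
      ∀ x : ℝ, 2 ≤ x →
        |Real.log ((NumberField.classNumber K : ℝ) * NumberField.Units.regulator K) -
            (∑ P ∈ (finite_primeIdealsLE K x).toFinset, -Real.log (1 - (Ideal.absNorm P : ℝ)⁻¹) -
              Real.log (Real.log x) - Real.eulerMascheroniConstant -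
              Real.log ((2 : ℝ) ^ NumberField.InfinitePlace.nrRealPlaces K *
                (2 * Real.pi) ^ NumberField.InfinitePlace.nrComplexPlaces K) +
              Real.log ((NumberField.Units.torsionOrder K : ℝ) * Real.sqrt |(NumberField.discr K : ℝ)|))| ≤
          Γ * Real.log (ThornerZaman.condQn K) ^ 2 / Real.log x ^ 2 := by
  obtain ⟨Γ, hΓ, h⟩ := mertens_third_uniform n hn
  refine ⟨Γ, hΓ, fun K _ _ hKn hnq x hx ↦ ?_⟩
  have hb := h K hKn hnq x hx
  -- unfold the residue
  have hR : 0 < NumberField.Units.regulator K := NumberField.Units.regulator_pos K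
  have hh : (0 : ℝ) < NumberField.classNumber K := Nat.cast_pos.mpr (NumberField.classNumber_pos K)
  have hw : (0 : ℝ) < NumberField.Units.torsionOrder K := Nat.cast_pos.mpr (NumberField.Units.torsionOrder_pos K)
  have hd : 0 < Real.sqrt |(NumberField.discr K : ℝ)| :=
    Real.sqrt_pos_of_pos (abs_pos.mpr (Int.cast_ne_zero.mpr (NumberField.discr_ne_zero K)))
  have hc : (0 : ℝ) < (2 : ℝ) ^ NumberField.InfinitePlace.nrRealPlaces K *
      (2 * Real.pi) ^ NumberField.InfinitePlace.nrComplexPlaces K := by positivity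
  have hκ : Real.log (NumberField.dedekindZeta_residue K) =
      Real.log ((2 : ℝ) ^ NumberField.InfinitePlace.nrRealPlaces K *
          (2 * Real.pi) ^ NumberField.InfinitePlace.nrComplexPlaces K) +
        Real.log ((NumberField.classNumber K : ℝ) * NumberField.Units.regulator K) -
        Real.log ((NumberField.Units.torsionOrder K : ℝ) * Real.sqrt |(NumberField.discr K : ℝ)|) := by
    rw [NumberField.dedekindZeta_residue_def, Real.log_div (by positivity) (by positivity),
      show (2 : ℝ) ^ NumberField.InfinitePlace.nrRealPlaces K * (2 * Real.pi) ^ NumberField.InfinitePlace.nrComplexPlaces K *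
          NumberField.Units.regulator K * (NumberField.classNumber K : ℝ) =
        ((2 : ℝ) ^ NumberField.InfinitePlace.nrRealPlaces K * (2 * Real.pi) ^ NumberField.InfinitePlace.nrComplexPlaces K) *
          ((NumberField.classNumber K : ℝ) * NumberField.Units.regulator K) by ring,
      Real.log_mul hc.ne' (by positivity)]
  rw [hκ] at hb
  refine le_trans (le_of_eq ?_) hb
  rw [← abs_neg]
  congr 1
  ring

/-- **Uniform Mertens III for every number field of ODD degree `n > 1`.** -/
theorem mertens_third_uniform_of_odd (n : ℕ) (hn : 1 < n) (hodd : Odd n) :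
    ∃ Γ : ℝ, 0 < Γ ∧ ∀ (K : Type) [Field K] [NumberField K], Module.finrank ℚ K = n →
      ∀ x : ℝ, 2 ≤ x →
        |∑ P ∈ (finite_primeIdealsLE K x).toFinset, -Real.log (1 - (Ideal.absNorm P : ℝ)⁻¹) -
            (Real.log (Real.log x) + Real.eulerMascheroniConstant +
              Real.log (NumberField.dedekindZeta_residue K))| ≤
          Γ * Real.log (ThornerZaman.condQn K) ^ 2 / Real.log x ^ 2 := by
  obtain ⟨Γ, hΓ, h⟩ := mertens_third_uniform n hn
  refine ⟨Γ, hΓ, fun K _ _ hKn ↦ h K hKn ?_⟩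
  have hoddK : Odd (Module.finrank ℚ K) := by rw [hKn]; exact hodd
  exact forall_finrank_ne_two_of_odd hoddK

/-- **Uniform Mertens III for every CUBIC field** (`Q = 27·|d_K|`): an absolute `Γ > 0` with
`|∑_{N𝔭 ≤ x} −log(1 − 1/N𝔭) − (log log x + γ + log κ_K)| ≤ Γ (log Q)²/(log x)²` for every cubic number field
`K` and all `x ≥ 2` — GRH-free, Siegel-free. -/
theorem mertens_third_uniform_cubic :
    ∃ Γ : ℝ, 0 < Γ ∧ ∀ (K : Type) [Field K] [NumberField K], Module.finrank ℚ K = 3 →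
      ∀ x : ℝ, 2 ≤ x →
        |∑ P ∈ (finite_primeIdealsLE K x).toFinset, -Real.log (1 - (Ideal.absNorm P : ℝ)⁻¹) -
            (Real.log (Real.log x) + Real.eulerMascheroniConstant +
              Real.log (NumberField.dedekindZeta_residue K))| ≤
          Γ * Real.log (ThornerZaman.condQn K) ^ 2 / Real.log x ^ 2 :=
  mertens_third_uniform_of_odd 3 (by norm_num) (by decide)

end Summit.QuantumAdvantage.QuantumAdvantage.Theorems.DegreeOnePrimesEscape

end
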